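import Summits.KontsevichZagierPeriods.KontsevichZagierPeriods.Theses.IsogenyCertificates
import Literature.NumberTheory.Transcendental.KZLogCalculusProofs
import Literature.NumberTheory.Transcendental.SemialgebraicAlgebraicPoints
import Summits.KontsevichZagierPeriods.KontsevichZagierPeriods.Theorems.EffectiveXMapChains.Negative.PeriodRep

/-!
# `AlgebraicModuliRealPeriodCell` (stmt-KontsevichZagierPeriods-18265) — negative knowledge I:
load-bearing analysis of the hypotheses

Landed copy of §2a–§3 of `Cruxes/AlgebraicModuliRealPeriodCell/Disproof.lean` (cdisprove seat).

* `isAlgebraic_of_rep`, `algebraicModuliRealPeriodCell_iff_without_isAlgebraic` — the three hypotheses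
  `IsAlgebraic ℚ α`, `IsAlgebraic ℚ β`, `IsAlgebraic ℚ a` of the crux's generators are DECORATION: for
  `a ≠ 0` they follow from the mere existence of the `KZ.IntegralRep 1` with domain `{P > 0}` and integrand
  `a/√P` (a `ℚ`-semialgebraic function has algebraic values at the integer points `N, …, N+3` of the domain,
  `IsSemialgebraicFunOn.isAlgebraic_apply`, and third/first finite differences of `P(n)/a²` pin
  `1/a², α/a², β/a²`), and `a = 0` generators are zero-integrand representations, i.e. relations. So the crux
  is EQUIVALENT to the same statement with the three hypotheses deleted: they can be neither load-bearing
  nor a source of vacuity.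
* `algebraicModuliRealPeriodCell_false_without_eval` — the hypothesis `KZ.eval c = 0` IS load-bearing:
  the generator `[{x³+1>0}, 1/√(x³+1)]` (the tree's `periodRep 0 1 1`) has value `Ω(E_{0,1}) > 0`, relations
  evaluate to `0`; in particular the generating set is non-empty and not inside `KZ.relations`
  (`gens_not_subset_relations`), so the crux is not vacuous.

No statement of the tree is changed; theorems only.
-/

noncomputable section

namespace Summit.KontsevichZagierPeriods.AlgebraicModuliRealPeriodCellNegative

open Set MeasureTheory
open Literature.NumberTheory.Transcendental
open Summit.KontsevichZagierPeriods.KontsevichZagierPeriods.Theses.IsogenyCertificates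
open Summit.KontsevichZagierPeriods.IsogenyCertificates.EffectiveXMapChainsNegative
  (periodRep periodRep_value realPeriod_pos)

/-! ## The algebraicity hypotheses are decoration -/

/-- Large arguments make a depressed cubic positive: `t ≥ |α| + |β| + 1 ⇒ t³ + αt + β > 0`. [folklore] -/
theorem cubic_pos_of_le {α β t : ℝ} (ht : |α| + |β| + 1 ≤ t) : 0 < t ^ 3 + α * t + β := by
  have hαn := abs_nonneg α
  have hβn := abs_nonneg β
  have h1 : (1 : ℝ) ≤ t := by linarith
  have h0 : (0 : ℝ) ≤ t := by linarith
  have hαt : -(|α| * t) ≤ α * t := by nlinarith [neg_abs_le α]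
  have hβ' : -|β| ≤ β := neg_abs_le β
  have ht2 : t ≤ t ^ 2 := by nlinarith
  have ht3 : t * (|α| + |β| + 1) ≤ t ^ 3 := by nlinarith
  have hβt : |β| ≤ |β| * t := by nlinarith
  nlinarith

/-- **The three `IsAlgebraic` hypotheses are implied by the existence of the representation** (`a ≠ 0`):
if a `KZ.IntegralRep 1` has domain `{P > 0}` and integrand `a/√P` on it, `P = x³ + αx + β`, then
`a, α, β` are algebraic over `ℚ`. The integrand is a `ℚ`-semialgebraic function, so its values at the
integer points `N, N+1, N+2, N+3 ∈ {P > 0}` (`N ≥ |α|+|β|+1`) are algebraic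
(`IsSemialgebraicFunOn.isAlgebraic_apply`); hence `g(n) = P(n)/a²` is algebraic there, and
`6/a² = Δ³g(N)`, `α/a² = Δg(N) − (3N²+3N+1)/a²`, `β/a² = g(N) − N³/a² − N·α/a²`. [folklore] -/
theorem isAlgebraic_of_rep {α β a : ℝ} (r : KZ.IntegralRep 1)
    (hd : r.domain = {x | 0 < x 0 ^ 3 + α * x 0 + β})
    (hi : EqOn r.integrand (fun x => a / Real.sqrt (x 0 ^ 3 + α * x 0 + β)) r.domain) (ha : a ≠ 0) :
    IsAlgebraic ℚ a ∧ IsAlgebraic ℚ α ∧ IsAlgebraic ℚ β := by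
  set K : IntermediateField ℚ ℝ := algebraicClosure ℚ ℝ with hK
  -- `g n = P(n)/a²` is algebraic for `n ≥ |α| + |β| + 1`
  have hg : ∀ n : ℕ, |α| + |β| + 1 ≤ (n : ℝ) → ((n : ℝ) ^ 3 + α * n + β) / a ^ 2 ∈ K := by
    intro n hn
    have hpos : 0 < (n : ℝ) ^ 3 + α * n + β := cubic_pos_of_le hn
    have hmem : (fun _ : Fin 1 => (n : ℝ)) ∈ r.domain := by
      rw [hd]
      simpa using hpos
    have halg : IsAlgebraic ℚ (r.integrand fun _ => (n : ℝ)) :=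
      r.isSemialgebraicFunOn_integrand.isAlgebraic_apply hmem fun _ => isAlgebraic_nat n
    rw [hi hmem] at halg
    have h2 : IsAlgebraic ℚ ((a / Real.sqrt ((n : ℝ) ^ 3 + α * n + β)) *
        (a / Real.sqrt ((n : ℝ) ^ 3 + α * n + β))) := halg.mul halg
    have hsq : (a / Real.sqrt ((n : ℝ) ^ 3 + α * n + β)) * (a / Real.sqrt ((n : ℝ) ^ 3 + α * n + β)) =
        a ^ 2 / ((n : ℝ) ^ 3 + α * n + β) := by
      rw [div_mul_div_comm, Real.mul_self_sqrt hpos.le, sq]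
    rw [hsq] at h2
    have h3 := h2.inv
    rw [inv_div] at h3
    exact mem_algebraicClosure_iff.2 h3
  obtain ⟨N, hN⟩ := exists_nat_ge (|α| + |β| + 1)
  have g0 := hg N hN
  have g1 := hg (N + 1) (by push_cast; linarith)
  have g2 := hg (N + 2) (by push_cast; linarith)
  have g3 := hg (N + 3) (by push_cast; linarith)
  push_cast at g1 g2 g3
  have h3K : (3 : ℝ) ∈ K := by simp
  have h6K : (6 : ℝ) ∈ K := by simp
  have hNK : (N : ℝ) ∈ K := natCast_mem K N
  -- u = 1/a²
  have hu_eq : (a ^ 2)⁻¹ = ((((N : ℝ) + 3) ^ 3 + α * ((N : ℝ) + 3) + β) / a ^ 2 -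
      3 * ((((N : ℝ) + 2) ^ 3 + α * ((N : ℝ) + 2) + β) / a ^ 2) +
      3 * ((((N : ℝ) + 1) ^ 3 + α * ((N : ℝ) + 1) + β) / a ^ 2) -
      ((N : ℝ) ^ 3 + α * N + β) / a ^ 2) / 6 := by
    field_simp
    ring
  have hu : (a ^ 2)⁻¹ ∈ K := by
    rw [hu_eq]
    exact div_mem (sub_mem (add_mem (sub_mem g3 (mul_mem h3K g2)) (mul_mem h3K g1)) g0) h6K
  -- v = α/a²
  have hv_eq : α / a ^ 2 = (((N : ℝ) + 1) ^ 3 + α * ((N : ℝ) + 1) + β) / a ^ 2 -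
      ((N : ℝ) ^ 3 + α * N + β) / a ^ 2 - (3 * (N : ℝ) ^ 2 + 3 * N + 1) * (a ^ 2)⁻¹ := by
    field_simp
    ring
  have hcoef : (3 * (N : ℝ) ^ 2 + 3 * N + 1) ∈ K :=
    add_mem (add_mem (mul_mem h3K (pow_mem hNK 2)) (mul_mem h3K hNK)) (one_mem K)
  have hv : α / a ^ 2 ∈ K := by
    rw [hv_eq]
    exact sub_mem (sub_mem g1 g0) (mul_mem hcoef hu)
  -- w = β/a²
  have hw_eq : β / a ^ 2 = ((N : ℝ) ^ 3 + α * N + β) / a ^ 2 - (N : ℝ) ^ 3 * (a ^ 2)⁻¹ -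
      (N : ℝ) * (α / a ^ 2) := by
    field_simp
    ring
  have hw : β / a ^ 2 ∈ K := by
    rw [hw_eq]
    exact sub_mem (sub_mem g0 (mul_mem (pow_mem hNK 3) hu)) (mul_mem hNK hv)
  -- back to `a, α, β`
  have ha2 : a ^ 2 ∈ K := by simpa using inv_mem hu
  have hαK : α ∈ K := by
    have : α = α / a ^ 2 * a ^ 2 := by field_simp
    rw [this]
    exact mul_mem hv ha2
  have hβK : β ∈ K := by
    have : β = β / a ^ 2 * a ^ 2 := by field_simp
    rw [this]
    exact mul_mem hw ha2
  refine ⟨?_, mem_algebraicClosure_iff.1 hαK, mem_algebraicClosure_iff.1 hβK⟩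
  exact IsAlgebraic.of_pow two_pos (mem_algebraicClosure_iff.1 ha2)

/-- Zero-scalar generators are relations (their integrand vanishes on the domain; tree:
`KZ.of_mem_relations_of_eqOn_zero`). [folklore] -/
theorem of_mem_relations_of_scalar_zero {α β a : ℝ} (r : KZ.IntegralRep 1)
    (hi : EqOn r.integrand (fun x => a / Real.sqrt (x 0 ^ 3 + α * x 0 + β)) r.domain) (ha : a = 0) :
    KZ.of r ∈ KZ.relations := by
  refine KZ.of_mem_relations_of_eqOn_zero r fun x hx => ?_
  rw [hi hx, ha]
  simp

/-- Every generator WITHOUT the algebraicity hypotheses is a generator of the cell or a relation. [folklore] -/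
theorem generator_without_isAlgebraic_mem {d : KZ.FormalRep}
    (hd : d ∈ {d : KZ.FormalRep | ∃ (α β a : ℝ) (r : KZ.IntegralRep 1), 4 * α ^ 3 + 27 * β ^ 2 ≠ 0 ∧
      r.domain = {x | 0 < x 0 ^ 3 + α * x 0 + β} ∧
      EqOn r.integrand (fun x => a / Real.sqrt (x 0 ^ 3 + α * x 0 + β)) r.domain ∧ d = KZ.of r}) :
    d ∈ {d : KZ.FormalRep | ∃ (α β a : ℝ) (r : KZ.IntegralRep 1), IsAlgebraic ℚ α ∧ IsAlgebraic ℚ β ∧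
      IsAlgebraic ℚ a ∧ 4 * α ^ 3 + 27 * β ^ 2 ≠ 0 ∧ r.domain = {x | 0 < x 0 ^ 3 + α * x 0 + β} ∧
      EqOn r.integrand (fun x => a / Real.sqrt (x 0 ^ 3 + α * x 0 + β)) r.domain ∧ d = KZ.of r} ∪
      (KZ.relations : Set KZ.FormalRep) := by
  obtain ⟨α, β, a, r, hΔ, hd, hi, rfl⟩ := hd
  by_cases ha : a = 0
  · exact Or.inr (of_mem_relations_of_scalar_zero r hi ha)
  · obtain ⟨h1, h2, h3⟩ := isAlgebraic_of_rep r hd hi ha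
    exact Or.inl ⟨α, β, a, r, h2, h3, h1, hΔ, hd, hi, rfl⟩

/-- **The three algebraicity hypotheses are decoration**: `AlgebraicModuliRealPeriodCell` is EQUIVALENT to
the same kernel statement over the generators `[{x³+αx+β>0}, a/√(x³+αx+β)]` with `α β a` ARBITRARY reals
(`4α³+27β² ≠ 0` kept). `→`: a generator with `a ≠ 0` has algebraic data (`isAlgebraic_of_rep`), one with
`a = 0` is a relation, so the larger closure is `closure gens ⊔ relations` and relations evaluate to `0`;
`←`: monotonicity of closures. [folklore] -/
theorem algebraicModuliRealPeriodCell_iff_without_isAlgebraic :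
    AlgebraicModuliRealPeriodCell ↔
      ∀ c ∈ AddSubgroup.closure {d : KZ.FormalRep | ∃ (α β a : ℝ) (r : KZ.IntegralRep 1),
          4 * α ^ 3 + 27 * β ^ 2 ≠ 0 ∧ r.domain = {x | 0 < x 0 ^ 3 + α * x 0 + β} ∧
          EqOn r.integrand (fun x => a / Real.sqrt (x 0 ^ 3 + α * x 0 + β)) r.domain ∧ d = KZ.of r},
        KZ.eval c = 0 → c ∈ KZ.relations := by
  constructor
  · intro h c hc hc0
    have hle : AddSubgroup.closure {d : KZ.FormalRep | ∃ (α β a : ℝ) (r : KZ.IntegralRep 1),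
          4 * α ^ 3 + 27 * β ^ 2 ≠ 0 ∧ r.domain = {x | 0 < x 0 ^ 3 + α * x 0 + β} ∧
          EqOn r.integrand (fun x => a / Real.sqrt (x 0 ^ 3 + α * x 0 + β)) r.domain ∧ d = KZ.of r} ≤
        AddSubgroup.closure {d : KZ.FormalRep | ∃ (α β a : ℝ) (r : KZ.IntegralRep 1), IsAlgebraic ℚ α ∧
          IsAlgebraic ℚ β ∧ IsAlgebraic ℚ a ∧ 4 * α ^ 3 + 27 * β ^ 2 ≠ 0 ∧
          r.domain = {x | 0 < x 0 ^ 3 + α * x 0 + β} ∧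
          EqOn r.integrand (fun x => a / Real.sqrt (x 0 ^ 3 + α * x 0 + β)) r.domain ∧ d = KZ.of r} ⊔
        KZ.relations := by
      rw [AddSubgroup.closure_le]
      intro d hd
      rcases generator_without_isAlgebraic_mem hd with hd | hd
      · exact AddSubgroup.mem_sup_left (AddSubgroup.subset_closure hd)
      · exact AddSubgroup.mem_sup_right hd
    obtain ⟨c₁, hc₁, c₂, hc₂, rfl⟩ := AddSubgroup.mem_sup.1 (hle hc)
    have h₂ : KZ.eval c₂ = 0 := AddMonoidHom.mem_ker.1 (KZ.relations_le_ker_eval_holds hc₂)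
    have h₁ : KZ.eval c₁ = 0 := by
      rw [map_add, h₂, add_zero] at hc0
      exact hc0
    exact add_mem (h c₁ hc₁ h₁) hc₂
  · intro h c hc hc0
    refine h c (AddSubgroup.closure_mono ?_ hc) hc0
    rintro d ⟨α, β, a, r, -, -, -, hΔ, hd, hi, rfl⟩
    exact ⟨α, β, a, r, hΔ, hd, hi, rfl⟩

/-! ## The value hypothesis `KZ.eval c = 0` is load-bearing; the crux is not vacuous -/

/-- The tree's period representations `[{x³+Ax+B>0}, a/√(x³+Ax+B)]` (`A B : ℤ`, `a : ℚ`) are generators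
of the cell. [folklore] -/
theorem of_periodRep_mem (A B : ℤ) (a : ℚ) (h : 4 * A ^ 3 + 27 * B ^ 2 ≠ 0) :
    KZ.of (periodRep A B a h) ∈ {d : KZ.FormalRep | ∃ (α β a : ℝ) (r : KZ.IntegralRep 1), IsAlgebraic ℚ α ∧
      IsAlgebraic ℚ β ∧ IsAlgebraic ℚ a ∧ 4 * α ^ 3 + 27 * β ^ 2 ≠ 0 ∧
      r.domain = {x | 0 < x 0 ^ 3 + α * x 0 + β} ∧
      EqOn r.integrand (fun x => a / Real.sqrt (x 0 ^ 3 + α * x 0 + β)) r.domain ∧ d = KZ.of r} := by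
  refine ⟨(A : ℝ), (B : ℝ), (a : ℝ), periodRep A B a h, isAlgebraic_int A, isAlgebraic_int B, ?_, ?_, rfl,
    fun x _ => rfl, rfl⟩
  · simpa using isAlgebraic_algebraMap (R := ℚ) (A := ℝ) a
  · exact_mod_cast h

/-- **`KZ.eval c = 0` is load-bearing**: the crux with this hypothesis deleted is FALSE — the generator
`[{x³+1>0}, 1/√(x³+1)]` has value `Ω(E_{0,1}) > 0` (`periodRep_value`, `realPeriod_pos`) while relations
evaluate to `0` (`KZ.relations_le_ker_eval_holds`). [folklore] -/
theorem algebraicModuliRealPeriodCell_false_without_eval :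
    ¬ ∀ c ∈ AddSubgroup.closure {d : KZ.FormalRep | ∃ (α β a : ℝ) (r : KZ.IntegralRep 1), IsAlgebraic ℚ α ∧
        IsAlgebraic ℚ β ∧ IsAlgebraic ℚ a ∧ 4 * α ^ 3 + 27 * β ^ 2 ≠ 0 ∧
        r.domain = {x | 0 < x 0 ^ 3 + α * x 0 + β} ∧
        EqOn r.integrand (fun x => a / Real.sqrt (x 0 ^ 3 + α * x 0 + β)) r.domain ∧ d = KZ.of r},
      c ∈ KZ.relations := by
  intro h
  have h27 : (4 : ℤ) * 0 ^ 3 + 27 * 1 ^ 2 ≠ 0 := by norm_num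
  have hmem := h _ (AddSubgroup.subset_closure (of_periodRep_mem 0 1 1 h27))
  have h0 : KZ.eval (KZ.of (periodRep 0 1 1 h27)) = 0 :=
    AddMonoidHom.mem_ker.1 (KZ.relations_le_ker_eval_holds hmem)
  rw [KZ.eval_of, periodRep_value] at h0
  have hpos := realPeriod_pos h27
  simp only [Rat.cast_one, one_mul] at h0
  exact hpos.ne' h0

/-- Hence the generating set of the cell is non-empty and NOT contained in `KZ.relations`: the crux is not
vacuous, and `eval c = 0` cannot be dropped. [folklore] -/
theorem gens_not_subset_relations :
    ¬ ({d : KZ.FormalRep | ∃ (α β a : ℝ) (r : KZ.IntegralRep 1), IsAlgebraic ℚ α ∧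
        IsAlgebraic ℚ β ∧ IsAlgebraic ℚ a ∧ 4 * α ^ 3 + 27 * β ^ 2 ≠ 0 ∧
        r.domain = {x | 0 < x 0 ^ 3 + α * x 0 + β} ∧
        EqOn r.integrand (fun x => a / Real.sqrt (x 0 ^ 3 + α * x 0 + β)) r.domain ∧ d = KZ.of r} ⊆
      (KZ.relations : Set KZ.FormalRep)) := fun h =>
  algebraicModuliRealPeriodCell_false_without_eval fun _ hc => (AddSubgroup.closure_le (K := KZ.relations)).2 h hc

end Summit.KontsevichZagierPeriods.AlgebraicModuliRealPeriodCellNegative
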